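import Summits.BirchSwinnertonDyer.Rank1Residual.GaloisImage.TateModuleFrobeniusPowInjective
import Summits.BirchSwinnertonDyer.Rank1Residual.GaloisImage.TateModuleEulerFactor
import Summits.BirchSwinnertonDyer.Rank1Residual.GaloisImage.FrobeniusPowerCongruence
import HarnessLib

/-!
# Frobenius on the Tate module at a Kolyvagin prime: `ρ(Fr)^m − 1` is injective on `T_pE`, and
# `(ρ(Fr) − 1)² T_pE ⊆ p T_pE` — file CK-2 of row T-DER-CK (THEOREM C's kernel inputs; cell
# `b2b-bsdres`, team n1011, seat p15 GEN 7; skel `cells/n1011/skel/T-DER-CK.md`)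

HONEST FRAMING (cell `b2b-bsdres`, run/shared/lean/b2b/bsd-rank1-residual/, verbatim in every
file): the goal of the cell is to DELETE the COMBINATION-SHAPED residual classes of the
Birch–Swinnerton-Dyer formula for ALL analytic-rank `≤ 1` elliptic curves over `ℚ` — "full BSD
formula for every rank `≤ 1` curve in class `C`" assembled STRICTLY from published theorems — so
that the rank-`≤ 1` remainder becomes exactly the CONSTRUCTION-SHAPED classes, which are TYPED
(missing-input `Prop`s), NOT attempted. This is not "finishing BSD". Team n1011: research route on
the CONSTRUCTION-SHAPED class X4 / §I N11 (route-1 PORT, (P-DER)); TOOL theorems (linear algebra in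
rank two + the tree's Tate-module facts); 0 defs, 0 named facts, 0 `sorry`; nothing is booked; no
mark / label / flag text moves; census −0.

## What (referee-1 GEN 35, THEOREM C proviso (iii): "the Kolyvagin-prime arithmetic … derived from
## `Kato.IsKolyvaginPrime` by a NAMED tree lemma")

Perrin-Riou's ascent for the Kolyvagin congruence (Ann. Inst. Fourier 48 (1998), Prop. 2.2.5 (ii);
tree files C0a `FrobeniusPowerCongruence`, C0b `KolyvaginCongruenceAscent` of p11 GEN 8) consumes two
facts about the Frobenius `F = ρ(Fr_q)` of `T = T_pE` at a good prime `q ≠ p`: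
* `hinj` / (FIN): **`F^m − 1` is injective on `T_pE` for every `m ≥ 1`** — no eigenvalue of
  Frobenius is a root of unity (Weil: `|α| = q^{1/2}`), here in F8a's elementary integer form
  `det(1 − F^m) = 1 − tr(F^m) + q^m ≠ 0` because `tr(F^m)² ≤ 4 q^m < (q^m + 1)²`
  (`injective_pow_sub_one_of_charpoly`, `injective_galoisRepTate_pow_sub_one`; the twin of F8a's
  `injective_pow_sub_smul_of_charpoly` / `injective_galoisRepTate_pow_sub` for the eigenvalue `1`
  instead of `q^m`);
* the room `(F − 1)² T ⊆ pT` (Perrin-Riou's condition (**) input, C0a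
  `Congruence.exists_sub_one_sub_one_eq_of_rank_two`): **at a Kolyvagin prime `q` of level
  `k ≥ 1` for `(E, p)` (`Kato.IsKolyvaginPrime W p k q`: `q ∤ Np`, `q ≡ 1`, `a_q ≡ q + 1 (mod p^k)`)
  one has `F² = a_q F − q` (Cayley–Hamilton on `T_pE`, the tree's `charpoly_tateModule_eq` /
  `trace_galoisRepTate_frobenius_eq_frobeniusTrace` / `det_…_holds`, as in K1) with `p ∣ a_q − 2`,
  `p ∣ q − 1`** — `Rat.exists_sub_one_sub_one_eq_galoisRepTate_of_isKolyvaginPrime` (and the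
  `F^f`-version by C0a's `exists_sub_one_sub_one_eq_pow`).
The operator identity `P(Fr⁻¹ ∣ T_pE*; F⁻¹) = (q − 1)·Z` (item (g) of the row) is n1011-p13's file
K4 `TateModuleEulerFactorOperator`.

References (context): B. Perrin-Riou, Ann. Inst. Fourier 48 (1998) §2.2.2 (**), Prop. 2.2.5;
J. H. Silverman, *AEC*, Thm. V.1.1, V.2.3.1, C.21; K. Rubin, *Euler Systems* (2000) §4.5.
-/

noncomputable section

open CategoryTheory Function Finset Polynomial Field IsDedekindDomain
open scoped NumberField
open Literature.NumberTheory.GaloisRepresentations Literature.NumberTheory.EllipticCurves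

universe u

namespace Summit.BirchSwinnertonDyer.Rank1Residual.GaloisImage

namespace Derivative

/-! ### §1 Linear algebra in rank two: `f^m − 1` is injective under Hasse -/

section Algebra

variable {R : Type*} [CommRing R] {M : Type*} [AddCommGroup M] [Module R M]

/-- **`f^m − 1` is injective** on a free rank-`2` module over a domain of characteristic zero when
`χ_f = X² − aX + q` with integers `a, q`, `a² ≤ 4q` (Hasse), `q ≥ 2` and `m ≥ 1`:
`det(1 − f^m) = χ_{f^m}(1) = 1 − tr(f^m) + q^m ≠ 0` since `tr(f^m)² ≤ 4q^m < (q^m + 1)²` (F8a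
`exists_trace_pow_eq_sq_le`).  (No eigenvalue of the Frobenius of `T_pE` at a good prime is an
`m`-th root of unity.)  Twin of F8a `injective_pow_sub_smul_of_charpoly`. [folklore] -/
theorem injective_pow_sub_one_of_charpoly [IsDomain R] [CharZero R] [Module.Free R M]
    [Module.Finite R M] (h2 : Module.finrank R M = 2) (f : Module.End R M) (a : ℤ) (q : ℕ)
    (hchar : f.charpoly = X ^ 2 - C (a : R) * X + C (q : R)) (hasse : a ^ 2 ≤ 4 * (q : ℤ))
    (hq : 2 ≤ q) {m : ℕ} (hm : 0 < m) :
    Function.Injective fun x : M => (f ^ m) x - x := by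
  classical
  haveI : Nontrivial R := inferInstance
  let b := Module.finBasisOfFinrankEq R M h2
  have hcp : ∀ g : Module.End R M,
      g.charpoly = X ^ 2 - C (LinearMap.trace R M g) * X + C (LinearMap.det g) := fun g => by
    rw [← LinearMap.charpoly_toMatrix g b, Matrix.charpoly_fin_two,
      ← LinearMap.trace_eq_matrix_trace R b g, LinearMap.det_toMatrix b g]
  have hcoef := hcp f
  rw [hchar] at hcoef
  have htr1 : LinearMap.trace R M f = a := by
    have h := congrArg (fun P : R[X] => P.coeff 1) hcoef
    simp only [coeff_add, coeff_sub, coeff_C_mul, coeff_X_pow, coeff_X_one, coeff_C,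
      if_neg (one_ne_zero), mul_one] at h
    simpa using h.symm
  have hdet : LinearMap.det f = (q : R) := by
    have h := congrArg (fun P : R[X] => P.coeff 0) hcoef
    simpa using h.symm
  have htr0 : LinearMap.trace R M (1 : Module.End R M) = 2 := by
    rw [LinearMap.trace_one, h2]; norm_num
  -- Cayley–Hamilton: `f² = a f − q`
  have hf : f * f = (a : R) • f - ((q : ℤ) : R) • 1 := by
    have h := LinearMap.aeval_self_charpoly f
    rw [hchar] at h
    simp only [map_add, map_sub, map_mul, aeval_X_pow, aeval_C, aeval_X,
      Algebra.algebraMap_eq_smul_one] at h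
    rw [Int.cast_natCast]
    have h' : f ^ 2 = (a : R) • (1 : Module.End R M) * f - (q : R) • 1 := by
      rw [← sub_eq_zero]; rw [← h]; abel
    rw [sq] at h'
    rw [h', smul_one_mul]
  obtain ⟨t, ht, htle⟩ := exists_trace_pow_eq_sq_le f a q hf htr0 (by exact_mod_cast htr1)
    (by exact_mod_cast hasse) m
  -- `det (1 − f^m)` is the non-zero integer `1 − t + q^m`
  have hqm : (2 : ℤ) ≤ (q : ℤ) ^ m := by
    calc (2 : ℤ) ≤ q := by exact_mod_cast hq
      _ = (q : ℤ) ^ 1 := (pow_one _).symm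
      _ ≤ (q : ℤ) ^ m := pow_le_pow_right₀ (by omega) hm
  have hne : (1 : ℤ) - t + (q : ℤ) ^ m ≠ 0 := by
    intro h
    have ht' : t = (q : ℤ) ^ m + 1 := by linarith
    rw [ht'] at htle
    nlinarith
  have hdetm : LinearMap.det (algebraMap R (Module.End R M) 1 - f ^ m) =
      (((1 : ℤ) - t + (q : ℤ) ^ m : ℤ) : R) := by
    rw [← LinearMap.eval_charpoly, hcp (f ^ m), ht, map_pow, hdet]
    simp only [eval_add, eval_sub, eval_mul, eval_pow, eval_C, eval_X]
    push_cast
    ring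
  have hdet0 : LinearMap.det (algebraMap R (Module.End R M) 1 - f ^ m) ≠ 0 := by
    rw [hdetm]
    exact_mod_cast hne
  have hinj := injective_of_det_ne_zero _ hdet0
  intro x y hxy
  apply hinj
  have h : (f ^ m) x - x = (f ^ m) y - y := hxy
  simp only [LinearMap.sub_apply, Module.algebraMap_end_apply, one_smul]
  rw [← neg_sub, ← neg_sub ((f ^ m) y), neg_inj]
  exact h

end Algebra

/-! ### §2 `T_pE` at a good place `v ∤ p`: `ρ(Fr)^m − 1` is injective -/

section Tate

variable {K : Type u} [Field K] [NumberField K] (W : WeierstrassCurve K) [W.IsElliptic]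
  (p : ℕ) [Fact p.Prime]

/-- **`ρ(Fr)^m − 1` is injective on `T_p E`** for every arithmetic Frobenius `Fr` at every
`𝔓 ∣ v`, `v ∤ p` of good reduction, and every `m ≥ 1` — no eigenvalue of Frobenius on `T_pE` is a
root of unity (Hasse–Weil: absolute value `q_v^{1/2}`).  This is the `hinj` of C0b
`Congruence.eq_add_rho_sub_of_sum_conj_eq` (at `φ^M = Fr^{fM}·`inertia, inertia acting trivially
on `T_pE` at good `v ∤ p`) and the "`1 ∉ Spec`" of THEOREM C's step (FIN).  Inputs as F8a's
`injective_galoisRepTate_pow_sub`. [cite: SilvermanAEC2009, Thm. V.1.1 and C.21 Remark 21.3] -/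
theorem injective_galoisRepTate_pow_sub_one {v : HeightOneSpectrum (𝓞 K)}
    (hpv : ((p : ℕ) : 𝓞 K) ∉ v.asIdeal) (hv : W.HasGoodReductionAt v)
    {𝔓 : Ideal (absIntegers (𝓞 K) K)} (h𝔓 : 𝔓 ∈ v.primesAbove) {σ : absoluteGaloisGroup K}
    (hσ : IsArithFrobAt (𝓞 K) σ 𝔓) {m : ℕ} (hm : 0 < m) :
    Function.Injective fun x : W.tateModule p => W.galoisRepTate p (σ ^ m) x - x := by
  haveI := W.module_free_tateModule_holds p
  haveI := W.module_finite_tateModule_holds p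
  have hpK : (p : K) ≠ 0 := by exact_mod_cast (Fact.out : p.Prime).ne_zero
  have hchar := WeierstrassCurve.charpoly_galoisRepTate_of_hasGoodReductionAt
    (W.trace_galoisRepTate_frobenius_of_hasGoodReductionAt_holds p)
    (W.det_galoisRepTate_frobenius_of_hasGoodReductionAt_holds p) hpv hv h𝔓 hσ
  have hq : Nat.card (IsLocalRing.ResidueField (v.adicCompletionIntegers K)) = v.residueCard := by
    rw [HeightOneSpectrum.natCard_residueField_adicCompletionIntegers,
      HeightOneSpectrum.residueCard_eq_card_quotient]
  rw [hq] at hchar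
  have hasse := frobeniusTraceAt_sq_le_four_mul W hv
  rw [hq] at hasse
  have h := injective_pow_sub_one_of_charpoly (WeierstrassCurve.finrank_tateModule_eq_two_holds W p hpK)
    (W.galoisRepTate p σ) (W.frobeniusTraceAt v) v.residueCard hchar hasse (two_le_residueCard v) hm
  rw [map_pow]
  exact h

/-- The same for an arithmetic Frobenius at the PLACE `v` (`IsArithFrobAtPlace`). [folklore] -/
theorem injective_galoisRepTate_pow_sub_one_of_isArithFrobAtPlace {v : HeightOneSpectrum (𝓞 K)}
    (hpv : ((p : ℕ) : 𝓞 K) ∉ v.asIdeal) (hv : W.HasGoodReductionAt v) {σ : absoluteGaloisGroup K}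
    (hσ : IsArithFrobAtPlace K v σ) {m : ℕ} (hm : 0 < m) :
    Function.Injective fun x : W.tateModule p => W.galoisRepTate p (σ ^ m) x - x := by
  obtain ⟨𝔓, h𝔓, hσ𝔓⟩ := hσ
  exact injective_galoisRepTate_pow_sub_one W p hpv hv h𝔓 hσ𝔓 hm

end Tate

end Derivative

/-! ### §3 `(ρ(Fr) − 1)² T_pE ⊆ p T_pE` at a Kolyvagin prime (E/ℚ) -/

namespace CyclotomicLevel.Rat

open Rat.HeightOneSpectrum

variable (W : WeierstrassCurve ℚ) [W.IsElliptic] [W.IsGloballyMinimal] (p : ℕ) [Fact p.Prime]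

/-- **Cayley–Hamilton on `T_pE` at a good place of `ℚ`, pointwise with INTEGER scalars**:
`F (F t) = a_q • F t − q • t` for `F = ρ(Fr)`, `a_q = W.frobeniusTrace q`, `q` the prime of the
good place `v ≠ p` (the tree's `charpoly_tateModule_eq`, `trace_galoisRepTate_frobenius_eq_frobeniusTrace`,
`det_galoisRepTate_frobenius_of_hasGoodReductionAt_holds`, as in K1 `rubinEulerFactor_galoisRepTate`).
This is the `hchar` binder of C0a `Congruence.exists_sub_one_sub_one_eq_of_rank_two`.
[cite: SilvermanAEC2009, Thm. V.2.3.1 and C.21 Remark 21.3] -/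
theorem galoisRepTate_apply_apply_eq_of_hasGoodReductionAt {v : HeightOneSpectrum (𝓞 ℚ)}
    (hne : ((primesEquiv v : Nat.Primes) : ℕ) ≠ p) (hv : W.HasGoodReductionAt v)
    {Fr : absoluteGaloisGroup ℚ} (hFr : IsArithFrobAtPlace ℚ v Fr) (t : W.tateModule p) :
    W.galoisRepTate p Fr (W.galoisRepTate p Fr t) =
      (W.frobeniusTrace (primesEquiv v) : ℤ) • W.galoisRepTate p Fr t -
        (((primesEquiv v : Nat.Primes) : ℕ) : ℤ) • t := by
  haveI := W.module_free_tateModule_holds p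
  haveI := W.module_finite_tateModule_holds p
  set q : ℕ := ((primesEquiv v : Nat.Primes) : ℕ) with hqdef
  obtain ⟨𝔓, h𝔓, hσ⟩ := hFr
  have hp : (p : 𝓞 ℚ) ∉ v.asIdeal :=
    WeierstrassCurve.natCast_not_mem_asIdeal_of_primesEquiv_ne Fact.out hne
  have hchar : (W.galoisRepTate p Fr).charpoly =
      X ^ 2 - C (W.frobeniusTrace (primesEquiv v) : ℤ_[p]) * X + C (q : ℤ_[p]) := by
    have hpℚ : (p : ℚ) ≠ 0 := Nat.cast_ne_zero.mpr (Fact.out : p.Prime).ne_zero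
    rw [WeierstrassCurve.charpoly_tateModule_eq hpℚ,
      W.trace_galoisRepTate_frobenius_eq_frobeniusTrace p hne hv h𝔓 hσ,
      W.det_galoisRepTate_frobenius_of_hasGoodReductionAt_holds p v hp hv h𝔓 hσ,
      WeierstrassCurve.natCard_residueField_adicCompletionIntegers]
  -- Cayley–Hamilton in `End`
  have h := LinearMap.aeval_self_charpoly (W.galoisRepTate p Fr)
  rw [hchar] at h
  simp only [map_add, map_sub, map_mul, aeval_X_pow, aeval_C, aeval_X,
    Algebra.algebraMap_eq_smul_one] at h
  have h' : (W.galoisRepTate p Fr) ^ 2 =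
      (W.frobeniusTrace (primesEquiv v) : ℤ_[p]) • (1 : Module.End ℤ_[p] (W.tateModule p)) *
        W.galoisRepTate p Fr - (q : ℤ_[p]) • 1 := by
    rw [← sub_eq_zero]; rw [← h]; abel
  have h'' := congrArg (fun G : Module.End ℤ_[p] (W.tateModule p) => G t) h'
  simp only [sq, Module.End.mul_apply, LinearMap.sub_apply, LinearMap.smul_apply,
    Module.End.one_apply, smul_one_mul] at h''
  rw [h'', ← Int.cast_smul_eq_zsmul ℤ_[p] (W.frobeniusTrace (primesEquiv v)),
    ← Int.cast_smul_eq_zsmul ℤ_[p] (q : ℤ), Int.cast_natCast]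

/-- **`(F − 1)² T_pE ⊆ p T_pE` at a Kolyvagin prime** — Perrin-Riou's condition (**) input, i.e.
C0a `Congruence.exists_sub_one_sub_one_eq_of_rank_two` DISCHARGED for the Frobenius `F = ρ(Fr)`
of `T_pE` at the place `v` of a Kolyvagin prime `q` of level `k ≥ 1` for `(W, p)`
(`Kato.IsKolyvaginPrime W p k q`: `q ∤ Np`, `q ≡ 1 (mod p^k)`, `a_q ≡ q + 1 (mod p^k)`; so
`p ∣ a_q − 2` and `p ∣ q − 1`): for every `t` there is `s` with `(F − 1)((F − 1) t) = p • s`.  The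
power `F^f` (the Frobenius of `ℚ(μ_r)_λ`) inherits it by C0a `Congruence.exists_sub_one_sub_one_eq_pow`.
[cite: PerrinRiou1998AIF, §2.2.2 condition (**)] -/
theorem exists_sub_one_sub_one_eq_galoisRepTate_of_isKolyvaginPrime {k : ℕ} (hk : 1 ≤ k)
    {v : HeightOneSpectrum (𝓞 ℚ)}
    (hq : Kato.IsKolyvaginPrime W p k ((primesEquiv v : Nat.Primes) : ℕ))
    {Fr : absoluteGaloisGroup ℚ} (hFr : IsArithFrobAtPlace ℚ v Fr) (t : W.tateModule p) :
    ∃ s : W.tateModule p,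
      (W.galoisRepTate p Fr - 1) ((W.galoisRepTate p Fr - 1) t) = p • s := by
  set q : ℕ := ((primesEquiv v : Nat.Primes) : ℕ) with hqdef
  have hne : q ≠ p := hq.ne
  have hv : W.HasGoodReductionAt v := hasGoodReductionAt_of_isKolyvaginPrime W hq
  have hpk : (p : ℤ) ∣ (p : ℤ) ^ k := dvd_pow_self _ (by omega)
  -- `p ∣ q − 1`
  have hq1 : (p : ℤ) ∣ (q : ℤ) - 1 := by
    have h1 : p ^ k ∣ q - 1 := (Nat.modEq_iff_dvd' hq.prime.one_lt.le).mp hq.modEq_one.symm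
    have h2 : ((p : ℤ) ^ k) ∣ (q : ℤ) - 1 := by
      have h := Int.natCast_dvd_natCast.mpr h1
      push_cast [Nat.cast_sub hq.prime.one_lt.le] at h
      exact h
    exact hpk.trans h2
  -- `p ∣ a_q − 2`
  have ha2 : (p : ℤ) ∣ W.frobeniusTrace (primesEquiv v) - 2 := by
    have h3 : ((p : ℤ) ^ k) ∣ W.frobeniusTrace (primesEquiv v) - ((q : ℤ) + 1) := by
      have h := (Int.ModEq.dvd hq.frobeniusTrace_modEq.symm)
      push_cast at h
      exact h
    have e : W.frobeniusTrace (primesEquiv v) - 2 =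
        (W.frobeniusTrace (primesEquiv v) - ((q : ℤ) + 1)) + ((q : ℤ) - 1) := by ring
    rw [e]
    exact dvd_add (hpk.trans h3) hq1
  exact Congruence.exists_sub_one_sub_one_eq_of_rank_two p (W.galoisRepTate p Fr)
    (W.frobeniusTrace (primesEquiv v)) (q : ℤ)
    (galoisRepTate_apply_apply_eq_of_hasGoodReductionAt W p hne hv hFr) ha2 hq1 t

/-- The same for the power `F^f` (the Frobenius of the level field at `λ ∣ q`): for every `t` there
is `s` with `(F^f − 1)((F^f − 1) t) = p • s` (C0a `Congruence.exists_sub_one_sub_one_eq_pow`).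
[folklore] -/
theorem exists_pow_sub_one_pow_sub_one_eq_galoisRepTate_of_isKolyvaginPrime {k : ℕ} (hk : 1 ≤ k)
    {v : HeightOneSpectrum (𝓞 ℚ)}
    (hq : Kato.IsKolyvaginPrime W p k ((primesEquiv v : Nat.Primes) : ℕ))
    {Fr : absoluteGaloisGroup ℚ} (hFr : IsArithFrobAtPlace ℚ v Fr) (f : ℕ) (t : W.tateModule p) :
    ∃ s : W.tateModule p,
      (W.galoisRepTate p Fr ^ f - 1) ((W.galoisRepTate p Fr ^ f - 1) t) = p • s :=
  Congruence.exists_sub_one_sub_one_eq_pow p (W.galoisRepTate p Fr)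
    (exists_sub_one_sub_one_eq_galoisRepTate_of_isKolyvaginPrime W p hk hq hFr) f t

end CyclotomicLevel.Rat

end Summit.BirchSwinnertonDyer.Rank1Residual.GaloisImage

end
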